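import Summits.BirchSwinnertonDyer.Rank1Residual.Additive.X4SharpThreeKimLattice
import Summits.BirchSwinnertonDyer.Rank1Residual.Additive.X4RankOneKimPartialLattice
import Summits.BirchSwinnertonDyer.Rank1Residual.Additive.X4RankOneKimTamagawaDefect
import Literature.NumberTheory.EllipticCurves.Kim2026.ShaLengthStructure
import HarnessLib

/-!
# The Kim lattice at `p ≥ 5` from ONE published fact: clause (6) AS PRINTED (harvest seat 2, E73)
# discharges the verbatim core `X4.KimShaLengthAt`, the `∂`-exact rank-`0` node `KimRankZeroShaLengthAt`
# AND — new — the rank-ONE node `KimRankOnePartialAt`, hence p17's TAMAGAWA-row consumers, at every `p ≥ 5`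
# (cell `b2b-bsdres`, team n1011; sibling of `X4SharpThreeKimLatticeFiveLe.lean`; p17 INBOX 06:33Z GO)

HONEST FRAMING (cell `b2b-bsdres`, run/shared/lean/b2b/bsd-rank1-residual/, verbatim in every
file): the goal of the cell is to DELETE the COMBINATION-SHAPED residual classes of the
Birch–Swinnerton-Dyer formula for ALL analytic-rank `≤ 1` elliptic curves over `ℚ` — "full BSD
formula for every rank `≤ 1` curve in class `C`" assembled STRICTLY from published theorems — so
that the rank-`≤ 1` remainder becomes exactly the CONSTRUCTION-SHAPED classes, which are TYPED
(missing-input `Prop`s), NOT attempted. This is not "finishing BSD". Team n1011: prove what is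
provable now; shrink each hard class to its core with data; no claim beyond stated classes;
research routes; census output = EVIDENCE, never a Literature fact. X4 stays CONSTRUCTION-SHAPED;
O7 / N11 marks unchanged; NOTHING below is booked. THEOREMS ONLY: every published input is an
explicit named-fact hypothesis; no new `Prop`; nothing re-declared (p17's / p03's / cc-typer-1's
predicates and lemmas are consumed by name).

## What this file proves

The Literature fact `hE73 = Kim2026.kuriharaPartial_vanishingOrder_eq_padicValNat_sha_add_partialInfty_of_maninConstant`
(file `Literature/NumberTheory/EllipticCurves/Kim2026/ShaLengthStructure.lean`; C.-H. Kim, Amer. J.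
Math. 148 (2026) Thm. 1.8 (6) = arXiv:2203.12159v4 Thm. 1.9 (6), EVERY vanishing order, `p ≥ 5`,
`ρ̄` onto, Manin datum, period transfer, `Ш` finite; cyclic levels — flag `Kim2026-(6)-cyclic-reading`,
referee R133.6 pattern) has, behind Kim's printed hypotheses, EXACTLY the body of cc-typer-1's
verbatim core `X4.KimShaLengthAt W p D.f`. Hence at every `p ≥ 5`:

* §1 `kimShaLengthAt_of_kim2026_of_five_le` — the core X1 for every datum and EVERY vanishing order
  (the rank-`0` sibling `X4SharpThreeKimLatticeFiveLe.kimShaLengthAt_of_kimFacts_…` needs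
  `L(E,1) ≠ 0` and two facts + modularity);
* §1 `kimRankZeroShaLengthAt_of_kim2026_of_five_le` — A5 (`KimRankZeroShaLengthAt W p`) from ONE
  fact, no modularity / conductor-level hypothesis (second route to p03's
  `kimRankZeroShaLengthAt_of_kimFacts_of_five_le`), and with it A2 ∧ A3 ∧ A4;
* §2 **`kimRankOnePartialAt_of_kim2026_of_five_le` — R3 (`KimRankOnePartialAt W p`, p17, the
  rank-one clause WITH its `∂^{(∞)}` term) is a THEOREM at `p ≥ 5`** (cells/n1011/KIM-AT-3-ANATOMY.md
  §(η).8 (4): "R3 at p ≥ 5: NO theorem … a rank-one ∂-exact fact is not typed" — now it is), hence `KimRankOneUnitAt` /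
  `KimRankOneLevelTwoAt` at `p ≥ 5` through p17's anti-drift lemmas;
* §3 p17's TAMAGAWA-row consumers (`X4RankOneKimTamagawaDefect.lean`) with `hK` DISCHARGED at
  `p ≥ 5`: on an `r_an = 1` pair with `ρ̄_{E,p}` + tower onto, a datum `D` with `p ∤ c_D` and the
  period transfer, the `≥` half of Kim's Conj. 1.10 (`X4.KimTamagawaDefectGeAt W p D.f`, p12, the
  ONE remaining typed input) and ONE Kurihara number non-zero modulo `p^{ord_p ∏c + 1}` at a cyclic
  Kolyvagin prime of that level give `#Ш(E/ℚ)(p) = 1`, and `BSD(E,p)` when `#Ш_an` is a `p`-unit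
  (Gross–Zagier–Kolyvagin + modularity as the cell's named facts). EVIDENCE (p17, cc-eng-1
  `class-closure/O7/pairs.tsv` sha16 27107d0f55816358): X4 ∧ surj ∧ `r = 1` ∧ `p ≥ 5` = 835 residue
  pairs, 470 of them TAM rows (`ord_p ∏c ≥ 1`) — there "two open items + one certificate" becomes
  "E73 (PUB\*) + Conj. 1.10 `≥`-half + one certificate". Nothing booked; per pair; ANY reduction at `p`
  (Kim's theorem has no reduction hypothesis);
* §4 registry: the tree's two rank-one Kim-(6) named facts
  (`Kim2022_rankOne_card_sha_eq_one_of_kuriharaNumber_ne_zero_of_maninConstant`,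
  `Kim2022_rankOne_padicValNat_sha_le_one_of_kuriharaNumber_levelTwo_ne_zero_of_maninConstant`, file
  `KuriharaNumberKimShaLength`, harvest seat 2 gens 5–6) are PROVED from E73 — readings of clause (6)
  at `∂^{(1)} = 0` resp. `∂^{(1)} ≤ 1`; they are DERIVED facts from now on (referee / lit registry);
* §5 registry: the rank-`0` Kim-(6) named facts that carry the period binder are PROVED from E73
  through cc-typer-1's BSD-currency bridge `X4.kimShaLengthRankZeroAt_of_kimShaLengthAt`: the unit
  fact `Kim2022_rankZero_padicValRat_sha_of_kuriharaNumber_ne_zero_of_maninConstant`, the LOWER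
  fact A182 `Kim2026.rankZero_le_padicValNat_sha_of_kuriharaNumber_ne_zero` (n1011-p11), the UPPER
  facts A197 `…_forall_pow_dvd_kuriharaNumber_cyclicLevel` and A179 `…_forall_pow_dvd_kuriharaNumber`
  (harvest-2 E67c / E67). NOT derived here (no period binder in their statements, or no datum):
  A161 `Kim2026.rankZero_padicValNat_sha_le_of_maninConstant` and the two semi-stable-prime unit
  facts without `_of_maninConstant`. Net for the registry: at `p ≥ 5` ONE Kim-(6) fact (E73) carries
  A179, A182, A197 and four `KuriharaNumberKimShaLength` facts; flag `Kim2026-(6)-cyclic-reading`.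

References: C.-H. Kim, Amer. J. Math. 148 (2026) 79–129 = arXiv:2203.12159v4, Thm. 1.9 (6), §1.5.1,
Conj. 1.10 [Kim2022StructureSelmer]; Miller, LMS J. Comput. Math. 14 (2011) Def. 1.1 [Miller2011LMS];
cell files cells/n1011/KIM-AT-3-ANATOMY.md §(η), cells/n1011/OWNERS.md (T-a2r1b, T-a2r1c), HOME
INBOX 2026-08-21 06:30Z (harvest-2 E73) / 06:33Z (p17 GO), HOME/b2b-bsdres-harvest-2/HARVEST.md §GEN-32.
-/

noncomputable section

open scoped Classical MatrixGroups ModularForm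

open CongruenceSubgroup WeierstrassCurve Literature.NumberTheory.EllipticCurves
  Literature.NumberTheory.EllipticCurves.ModularForms
  Literature.NumberTheory.EllipticCurves.Rank1Residual
  Literature.NumberTheory.EllipticCurves.Rank1Residual.Typed

namespace Summit.BirchSwinnertonDyer.Rank1Residual.Additive

open Summit.BirchSwinnertonDyer.Rank1Residual.X4

variable (W : WeierstrassCurve ℚ) [W.IsElliptic] [W.IsGloballyMinimal] (p : ℕ) [Fact p.Prime]

/-! ## §1 The verbatim core and the rank-`0` node at `p ≥ 5` from the ONE fact -/

/-- **X1 at `p ≥ 5`, every datum, EVERY vanishing order**: Kim's clause (6) as printed (`hE73`)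
is, behind its hypotheses (`5 ≤ p`, `ρ̄` onto, `Ш` finite, `p ∤ c_D`, period transfer), the core
`X4.KimShaLengthAt W p D.f`. One application. [cite: Kim2022StructureSelmer, Thm. 1.9 (6) (PDF p. 8)] -/
theorem kimShaLengthAt_of_kim2026_of_five_le
    (hE73 : Kim2026.kuriharaPartial_vanishingOrder_eq_padicValNat_sha_add_partialInfty_of_maninConstant)
    (hp : 5 ≤ p) (hsurj : W.HasSurjectiveModNGaloisRep p) (hfin : Finite W.sha)
    {N : ℕ} [NeZero N] (D : ModularParametrizationData W N) (hc : ¬ (p : ℤ) ∣ D.maninConstant)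
    (hper : ∃ u : ℚ, ‖(u : ℚ_[p])‖ = 1 ∧ W.realPeriodRat = u * plusPeriod D.f) :
    KimShaLengthAt W p D.f :=
  hE73 W p hp hsurj hfin D hc hper

/-- **A5 at `p ≥ 5` from ONE fact**: `KimRankZeroShaLengthAt W p` (cc-typer-1's `∂`-exact rank-`0`
shape) through p03's `kimRankZeroShaLengthAt_iff_forall_kimShaLengthAt`; no modularity or
conductor-level hypothesis (compare `kimRankZeroShaLengthAt_of_kimFacts_of_five_le`: two one-sided
facts + `exists_isNewformOf`). The tower and `L(E,1) ≠ 0` binders are not used by the fact.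
[cite: Kim2022StructureSelmer, Thm. 1.9 (6) (PDF p. 8), §1.4.3 and §1.5.1 (PDF p. 7)] -/
theorem kimRankZeroShaLengthAt_of_kim2026_of_five_le
    (hE73 : Kim2026.kuriharaPartial_vanishingOrder_eq_padicValNat_sha_add_partialInfty_of_maninConstant)
    (hp : 5 ≤ p) : KimRankZeroShaLengthAt W p :=
  (kimRankZeroShaLengthAt_iff_forall_kimShaLengthAt W p (by omega)).mpr
    fun hsurj _ _ hfin _ _ D hc hper => hE73 W p hp hsurj hfin D hc hper

/-- **A2 ∧ A3 ∧ A4 at `p ≥ 5` from ONE fact** (unit / LOWER / UPPER-div shapes through A5; compare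
p03's `kimRankZero_unit_lower_upperDiv_of_kimFacts_of_five_le`). Bookkeeping.
[cite: Kim2022StructureSelmer, Thm. 1.9 (1) and (6) (PDF pp. 7–8)] -/
theorem kimRankZero_unit_lower_upperDiv_of_kim2026_of_five_le
    (hE73 : Kim2026.kuriharaPartial_vanishingOrder_eq_padicValNat_sha_add_partialInfty_of_maninConstant)
    (hp : 5 ≤ p) :
    KimRankZeroUnitBoundAt W p ∧ KimRankZeroLowerBoundAt W p ∧ KimRankZeroUpperDivBoundAt W p :=
  have h5 := kimRankZeroShaLengthAt_of_kim2026_of_five_le W p hE73 hp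
  ⟨kimRankZeroUnitBoundAt_of_kimRankZeroShaLengthAt W p h5,
    kimRankZeroLowerBoundAt_of_kimRankZeroShaLengthAt W p h5,
    kimRankZeroUpperDivBoundAt_of_kimRankZeroShaLengthAt W p h5⟩

/-! ## §2 NEW: the rank-ONE node `KimRankOnePartialAt W p` is a theorem at `p ≥ 5` -/

/-- **R3 at `p ≥ 5`: `KimRankOnePartialAt W p` (p17: `length_{ℤ_p} Ш(E/ℚ)[p^∞] + ∂^{(∞)}(δ̃) =
∂^{(1)}(δ̃)` under the rank-one binders) from Kim's clause (6) as printed.** Under the binders,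
`L(E,1) = 0` makes `δ̃_1 = 0` (`kuriharaDivIndex_one_eq_top_of_entireLFunction_one_eq_zero`, via
`D.isNewformOf`) and `∂^{(1)} ≠ ⊤` makes `ord(δ̃) = 1` (`kuriharaVanishingOrder_eq_one`); the fact at
vanishing order `1` (`Kim2026.padicValNat_sha_add_partialInfty_eq_kuriharaPartial_one`) is the
conclusion. The tower and `r_an = 1` binders are carried, not used. Flag of the fact inherited
(`Kim2026-(6)-cyclic-reading`). [cite: Kim2022StructureSelmer, Thm. 1.9 (1), (4) and (6) (PDF pp. 7–8), §1.4.3–1.4.4 and §1.5.1 (PDF p. 7)] -/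
theorem kimRankOnePartialAt_of_kim2026_of_five_le
    (hE73 : Kim2026.kuriharaPartial_vanishingOrder_eq_padicValNat_sha_add_partialInfty_of_maninConstant)
    (hp : 5 ≤ p) : KimRankOnePartialAt W p := by
  intro hsurj _ hL _ hfin N _ D hc hper hne
  have h1 : kuriharaDivIndex W p D.f 1 = ⊤ :=
    kuriharaDivIndex_one_eq_top_of_entireLFunction_one_eq_zero W p D.f D.isNewformOf hL
  exact Kim2026.padicValNat_sha_add_partialInfty_eq_kuriharaPartial_one W p hp hsurj hfin D hc hper
    hE73 (kuriharaVanishingOrder_eq_one W p D.f h1 hne)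

/-- **Every-curve forms at `p ≥ 5`**: `∀ W, KimRankOnePartialAt W p` — the `p ≥ 5` analogue of p17's
`KimThreeRankOnePartial` is a theorem. [cite: Kim2022StructureSelmer, Thm. 1.9 (6) (PDF p. 8)] -/
theorem forall_kimRankOnePartialAt_of_kim2026_of_five_le
    (hE73 : Kim2026.kuriharaPartial_vanishingOrder_eq_padicValNat_sha_add_partialInfty_of_maninConstant)
    (hp : 5 ≤ p) :
    ∀ (W : WeierstrassCurve ℚ) [W.IsElliptic] [W.IsGloballyMinimal], KimRankOnePartialAt W p :=
  fun W _ _ => kimRankOnePartialAt_of_kim2026_of_five_le W p hE73 hp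

/-- **The unit and level-two rank-one shapes at `p ≥ 5` through R3** (p17's anti-drift lemmas
`kimRankOneUnitAt_of_partial`, `kimRankOneLevelTwoAt_of_partial`): `KimRankOneUnitAt W p ∧
KimRankOneLevelTwoAt W p`. Their direct STEP-0 antecedents are the two rank-one `_of_maninConstant`
facts of `KuriharaNumberKimShaLength` (now readings of E73 at `∂^{(1)} ∈ {0, ≤ 1}`). Bookkeeping.
[cite: Kim2022StructureSelmer, Thm. 1.9 (6) (PDF p. 8), §1.2.2 and §1.5.1 (PDF pp. 5–7)] -/
theorem kimRankOne_unit_levelTwo_of_kim2026_of_five_le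
    (hE73 : Kim2026.kuriharaPartial_vanishingOrder_eq_padicValNat_sha_add_partialInfty_of_maninConstant)
    (hp : 5 ≤ p) : KimRankOneUnitAt W p ∧ KimRankOneLevelTwoAt W p :=
  have hK := kimRankOnePartialAt_of_kim2026_of_five_le W p hE73 hp
  ⟨kimRankOneUnitAt_of_partial W p hK, kimRankOneLevelTwoAt_of_partial W p hK⟩

/-! ## §3 p17's TAMAGAWA-row consumers with the rank-one clause DISCHARGED at `p ≥ 5` -/

/-- **`#Ш(E/ℚ)(p) = 1` at `p ≥ 5` on a rank-one TAM row from ONE Kurihara number at the EXACT level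
`k = ord_p ∏c_ℓ + 1`**, modulo ONLY the `≥` half of Kim's Conj. 1.10 (`hGe : X4.KimTamagawaDefectGeAt
W p D.f`, p12's typed input): p17's `card_primaryComponent_eq_one_of_partial_of_tamagawaDefectGe`
with `hK` supplied by Kim's published theorem (E73). Hypotheses: `ρ̄_{E,p}` and the tower onto,
`L(E,1) = 0`, `r_an = 1`, `Ш` finite, `D` with `p ∤ c_D`, period transfer, a cyclic Kolyvagin prime
`ℓ ∈ 𝒫_k` with `δ̃_ℓ ≢ 0 (mod p^k)`. ANY reduction at `p`; per pair; nothing booked.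
[cite: Kim2022StructureSelmer, Thm. 1.9 (6) and Conj. 1.10 (PDF p. 8)] -/
theorem card_primaryComponent_eq_one_of_kim2026_of_tamagawaDefectGe_of_five_le
    (hE73 : Kim2026.kuriharaPartial_vanishingOrder_eq_padicValNat_sha_add_partialInfty_of_maninConstant)
    (hp : 5 ≤ p) (hsurj : W.HasSurjectiveModNGaloisRep p)
    (htower : ∀ n : ℕ, W.HasSurjectiveModNGaloisRep (p ^ n : ℕ)) (hL : W.entireLFunction 1 = 0)
    (hr : W.analyticRank = 1) (hfin : Finite W.sha)
    {N : ℕ} [NeZero N] (D : ModularParametrizationData W N) (hc : ¬ (p : ℤ) ∣ D.maninConstant)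
    (hper : ∃ u : ℚ, ‖(u : ℚ_[p])‖ = 1 ∧ W.realPeriodRat = u * plusPeriod D.f)
    (hGe : X4.KimTamagawaDefectGeAt W p D.f)
    (ℓ : ℕ) [Fact ℓ.Prime] (hℓ : Kato.IsKolyvaginPrime W p (padicValNat p W.tamagawaProduct + 1) ℓ)
    (hcyc : Nat.card {P : ((WeierstrassCurve.integralModelInt W).map
        (Int.castRingHom (ZMod ℓ))).toAffine.Point // p • P = 0} ≤ p)
    (ψ : (ℓ' : ℕ) → (ZMod ℓ')ˣ →* Multiplicative (ZMod (p ^ (padicValNat p W.tamagawaProduct + 1))))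
    (hψ : Function.Surjective (ψ ℓ))
    (hδ : kuriharaNumber D.f (p ^ (padicValNat p W.tamagawaProduct + 1)) ℓ ψ ≠ 0) :
    Nat.card (AddCommGroup.primaryComponent W.sha p) = 1 :=
  card_primaryComponent_eq_one_of_partial_of_tamagawaDefectGe W p
    (kimRankOnePartialAt_of_kim2026_of_five_le W p hE73 hp) hsurj htower hL hr hfin D hc hper hGe ℓ
    hℓ hcyc ψ hψ hδ

/-- **`BSD(E,p)` at `p ≥ 5` on a rank-one TAM row with `#Ш_an` a `p`-unit, from ONE Kurihara number
at the exact level**, modulo ONLY the `≥` half of Conj. 1.10 (`hGe`), with Gross–Zagier–Kolyvagin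
(`hGZK`) and modularity (`hmod`) as the cell's named facts: p17's
`bsdp_of_partial_of_tamagawaDefectGe_of_shaAn_unit` with `hK` supplied by E73. ANY reduction at `p`;
per pair; NOT a class theorem; nothing booked. [cite: Kim2022StructureSelmer, Thm. 1.9 (6) and Conj. 1.10 (PDF p. 8)]
[cite: Miller2011LMS, Def. 1.1] -/
theorem bsdp_of_kim2026_of_tamagawaDefectGe_of_shaAn_unit_of_five_le
    (hE73 : Kim2026.kuriharaPartial_vanishingOrder_eq_padicValNat_sha_add_partialInfty_of_maninConstant)
    (hGZK : rank_eq_analyticRank_of_analyticRank_le_one) (hmod : hasEntireLFunction_rat)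
    (hp : 5 ≤ p) (hsurj : W.HasSurjectiveModNGaloisRep p)
    (htower : ∀ n : ℕ, W.HasSurjectiveModNGaloisRep (p ^ n : ℕ)) (hr : W.analyticRank = 1)
    {N : ℕ} [NeZero N] (D : ModularParametrizationData W N) (hc : ¬ (p : ℤ) ∣ D.maninConstant)
    (hper : ∃ u : ℚ, ‖(u : ℚ_[p])‖ = 1 ∧ W.realPeriodRat = u * plusPeriod D.f)
    (hGe : X4.KimTamagawaDefectGeAt W p D.f)
    (ℓ : ℕ) [Fact ℓ.Prime] (hℓ : Kato.IsKolyvaginPrime W p (padicValNat p W.tamagawaProduct + 1) ℓ)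
    (hcyc : Nat.card {P : ((WeierstrassCurve.integralModelInt W).map
        (Int.castRingHom (ZMod ℓ))).toAffine.Point // p • P = 0} ≤ p)
    (ψ : (ℓ' : ℕ) → (ZMod ℓ')ˣ →* Multiplicative (ZMod (p ^ (padicValNat p W.tamagawaProduct + 1))))
    (hψ : Function.Surjective (ψ ℓ))
    (hδ : kuriharaNumber D.f (p ^ (padicValNat p W.tamagawaProduct + 1)) ℓ ψ ≠ 0)
    {q : ℚ} (hq : shaAn W = (q : ℂ)) (hv : padicValRat p q = 0) : BSDp W p :=
  bsdp_of_partial_of_tamagawaDefectGe_of_shaAn_unit W p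
    (kimRankOnePartialAt_of_kim2026_of_five_le W p hE73 hp) hGZK hmod hsurj htower hr D hc hper hGe ℓ
    hℓ hcyc ψ hψ hδ hq hv

/-! ## §4 Registry: the tree's two rank-one Kim-(6) facts are READINGS of E73 (derived, `p ≥ 5`) -/

/-- **The rank-one UNIT fact is a reading of E73**: harvest-2's
`Kim2022_rankOne_card_sha_eq_one_of_kuriharaNumber_ne_zero_of_maninConstant` (file
`KuriharaNumberKimShaLength`: a unit Kurihara number at a cyclic Kolyvagin prime ⇒ `#Ш(E/ℚ)(p) = 1`)
follows from clause (6) as printed — `L(E,1) = 0` gives `δ̃_1 = 0`, the unit gives `∂^{(1)} = 0`,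
so `ord(δ̃) = 1` and `ord_p #Ш(p) + ∂^{(∞)} = 0`. Registry: that fact is DERIVED ⇐ E73 (one
independent Kim-(6) fact fewer). [cite: Kim2022StructureSelmer, Thm. 1.9 (1), (4) and (6) (PDF pp. 7–8), §1.5.1 (PDF p. 7)] -/
theorem kim2022_rankOne_card_sha_eq_one_of_maninConstant_of_kim2026
    (hE73 : Kim2026.kuriharaPartial_vanishingOrder_eq_padicValNat_sha_add_partialInfty_of_maninConstant) :
    Kim2022_rankOne_card_sha_eq_one_of_kuriharaNumber_ne_zero_of_maninConstant := by
  intro W _ _ p _ hp hsurj hL _ hfin N _ D hc hper ℓ _ hℓ hcyc ψ hψ hδ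
  haveI : Finite W.sha := hfin
  have h1 : kuriharaDivIndex W p D.f 1 = ⊤ :=
    kuriharaDivIndex_one_eq_top_of_entireLFunction_one_eq_zero W p D.f D.isNewformOf hL
  have hℓp : ℓ.Prime := Fact.out
  have hcl : IsCyclicKolyvaginLevel W p ℓ := isCyclicKolyvaginLevel_of_prime W p le_rfl hℓ hcyc
  have hcard : ℓ.primeFactors.card = 1 := by rw [hℓp.primeFactors, Finset.card_singleton]
  have hψ' : ∀ ℓ' ∈ ℓ.primeFactors, Function.Surjective (ψ ℓ') := by
    intro ℓ' hℓ'
    rw [hℓp.primeFactors, Finset.mem_singleton] at hℓ'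
    subst hℓ'
    exact hψ
  have h0 : kuriharaPartial W p D.f 1 = 0 :=
    kuriharaPartial_eq_zero_of_ne_zero W p D.f hcl hcard ψ hψ' hδ
  have hord : kuriharaVanishingOrder W p D.f = 1 :=
    kuriharaVanishingOrder_eq_one W p D.f h1 (by rw [h0]; exact ENat.zero_ne_top)
  have hmain := Kim2026.padicValNat_sha_add_partialInfty_eq_kuriharaPartial_one W p hp hsurj hfin D
    hc hper hE73 hord
  rw [h0, add_eq_zero] at hmain
  exact card_primaryComponent_eq_one_of_padicValNat_eq_zero W p (by exact_mod_cast hmain.1)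

/-- **The rank-one LEVEL-TWO fact is a reading of E73**: harvest-2's
`Kim2022_rankOne_padicValNat_sha_le_one_of_kuriharaNumber_levelTwo_ne_zero_of_maninConstant`
(a Kurihara number non-zero modulo `p²` at a cyclic `ℓ ∈ 𝒫₂` ⇒ `ord_p #Ш(E/ℚ)(p) ≤ 1`) follows
from clause (6) as printed (`∂^{(1)} ≤ 1`, `∂^{(∞)} ≥ 0`). Registry: DERIVED ⇐ E73.
[cite: Kim2022StructureSelmer, Thm. 1.9 (6) (PDF p. 8), §1.2.2 and §1.5.1 (PDF pp. 5–7)] -/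
theorem kim2022_rankOne_padicValNat_sha_le_one_levelTwo_of_maninConstant_of_kim2026
    (hE73 : Kim2026.kuriharaPartial_vanishingOrder_eq_padicValNat_sha_add_partialInfty_of_maninConstant) :
    Kim2022_rankOne_padicValNat_sha_le_one_of_kuriharaNumber_levelTwo_ne_zero_of_maninConstant := by
  intro W _ _ p _ hp hsurj hL _ hfin N _ D hc hper ℓ _ hℓ hcyc ψ hψ hδ
  have h1 : kuriharaDivIndex W p D.f 1 = ⊤ :=
    kuriharaDivIndex_one_eq_top_of_entireLFunction_one_eq_zero W p D.f D.isNewformOf hL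
  have hle : kuriharaPartial W p D.f 1 ≤ ((2 - 1 : ℕ) : ℕ∞) :=
    kuriharaPartial_one_le_of_kuriharaNumber_ne_zero W p D.f (by norm_num) hℓ hcyc ψ hψ hδ
  have hne : kuriharaPartial W p D.f 1 ≠ ⊤ := ne_top_of_le_ne_top (ENat.coe_ne_top _) hle
  have hord : kuriharaVanishingOrder W p D.f = 1 := kuriharaVanishingOrder_eq_one W p D.f h1 hne
  have h := (Kim2026.padicValNat_sha_le_kuriharaPartial_one W p hp hsurj hfin D hc hper hE73 hord).trans
    hle
  exact_mod_cast h

/-! ## §5 Registry: the tree's rank-`0` Kim-(6) facts WITH the period binder are READINGS of E73 -/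

/-- **The rank-`0` UNIT fact is a reading of E73**: harvest-2's / x11a's
`Kim2022_rankZero_padicValRat_sha_of_kuriharaNumber_ne_zero_of_maninConstant` (a unit Kurihara
number at a cyclic level ⇒ `L(E,1)/Ω(W) = q` with `ord_p q = ord_p #Ш(E/ℚ)(p)`) follows from clause
(6) as printed through cc-typer-1's BSD-currency bridge `X4.kimShaLengthRankZeroAt_of_kimShaLengthAt`
(`∂^{(0)} = ord_p(L(E,1)/Ω)`) and `∂^{(∞)} = 0` (`kuriharaPartialInfty_eq_zero_of_ne_zero`).
Registry: DERIVED ⇐ E73. [cite: Kim2022StructureSelmer, Thm. 1.9 (6) (PDF p. 8), §1.4.3 and §1.5.1 (PDF p. 7)] -/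
theorem kim2022_rankZero_padicValRat_sha_of_maninConstant_of_kim2026
    (hE73 : Kim2026.kuriharaPartial_vanishingOrder_eq_padicValNat_sha_add_partialInfty_of_maninConstant) :
    Kim2022_rankZero_padicValRat_sha_of_kuriharaNumber_ne_zero_of_maninConstant := by
  intro W _ _ p _ hp hsurj hL hfin N _ D hc hper n _ hn hcyc ψ hψ hδ
  obtain ⟨q, d, hq, hd, hval⟩ := kimShaLengthRankZeroAt_of_kimShaLengthAt W p (by omega)
    (hasIrreducibleModPGaloisRep_of_hasSurjectiveModNGaloisRep W p hsurj) hL D hper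
    (hE73 W p hp hsurj hfin D hc hper)
  have h0 : kuriharaPartialInfty W p D.f = 0 :=
    kuriharaPartialInfty_eq_zero_of_ne_zero W p D.f ⟨hn, hcyc⟩ ψ hψ hδ
  rw [h0] at hd
  have hd0 : d = 0 := by exact_mod_cast hd.symm
  exact ⟨q, hq, by rw [hval, hd0, Nat.cast_zero, add_zero]⟩

/-- **The rank-`0` LOWER fact (A182, n1011-p11) is a reading of E73**:
`Kim2026.rankZero_le_padicValNat_sha_of_kuriharaNumber_ne_zero` (ONE Kurihara number non-zero
modulo `p^k` at a cyclic level `n ∈ 𝒩_k` ⇒ `ord_p(L(E,1)/Ω(W)) ≤ ord_p #Ш(E/ℚ)(p) + (k − 1)`):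
clause (6) at vanishing order `0` with `∂^{(∞)} ≤ ∂^{(ν(n))} ≤` (divisibility index of `δ̃_n`)
`≤ k − 1`. Registry: DERIVED ⇐ E73 (flag `Kim2026-(6)-cyclic-reading` on both).
[cite: Kim2022StructureSelmer, Thm. 1.9 (6) (PDF p. 8), §1.5.1 (PDF p. 7), Def. 2.13 (PDF p. 14)] -/
theorem kim2026_rankZero_le_padicValNat_sha_of_kim2026
    (hE73 : Kim2026.kuriharaPartial_vanishingOrder_eq_padicValNat_sha_add_partialInfty_of_maninConstant) :
    Kim2026.rankZero_le_padicValNat_sha_of_kuriharaNumber_ne_zero := by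
  intro W _ _ p _ hp hsurj hL hfin N _ D hc hper k n _ hk hn hcyc ψ hψ hδ
  obtain ⟨q, d, hq, hd, hval⟩ := kimShaLengthRankZeroAt_of_kimShaLengthAt W p (by omega)
    (hasIrreducibleModPGaloisRep_of_hasSurjectiveModNGaloisRep W p hsurj) hL D hper
    (hE73 W p hp hsurj hfin D hc hper)
  have hcl : IsCyclicKolyvaginLevel W p n := ⟨hn.mono hk, hcyc⟩
  have hdle : (d : ℕ∞) ≤ ((k - 1 : ℕ) : ℕ∞) := by
    rw [← hd]
    exact ((kuriharaPartialInfty_le W p D.f _).trans (kuriharaPartial_le W p D.f hcl rfl)).trans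
      (kuriharaDivIndex_le_of_kuriharaNumber_ne_zero W p D.f hn ψ hψ hδ)
  have hdle' : d ≤ k - 1 := by exact_mod_cast hdle
  refine ⟨q, hq, ?_⟩
  rw [hval]
  have hcast : (d : ℤ) ≤ ((k - 1 : ℕ) : ℤ) := Int.ofNat_le.mpr hdle'
  linarith

/-- **The rank-`0` UPPER facts (A197 cyclic, hence A179 literal — harvest-2 E67c / E67) are readings
of E73**: `Kim2026.rankZero_padicValNat_sha_add_le_of_forall_pow_dvd_kuriharaNumber_cyclicLevel`
(every cyclic-level Kurihara number divisible by `p^{min(m,k)}` ⇒ `ord_p #Ш(E/ℚ)(p) + m ≤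
ord_p(L(E,1)/Ω(W))`): the universal divisibility gives `m ≤ ∂^{(∞)}` (`KuriharaDivisibleAt` at
every cyclic level, `le_kuriharaDivIndex_of_divisibleAt`), and clause (6) at vanishing order `0`
gives `ord_p(L/Ω) = ord_p #Ш(p) + ∂^{(∞)}`. The literal-level A179 follows by
`Kim2026.rankZero_padicValNat_sha_add_le_of_forall_pow_dvd_kuriharaNumber_of_cyclicLevel`.
Registry: A197 and A179 DERIVED ⇐ E73. [cite: Kim2022StructureSelmer, Thm. 1.9 (6) (PDF p. 8), §1.5.1 (PDF p. 7)] -/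
theorem kim2026_rankZero_padicValNat_sha_add_le_cyclicLevel_of_kim2026
    (hE73 : Kim2026.kuriharaPartial_vanishingOrder_eq_padicValNat_sha_add_partialInfty_of_maninConstant) :
    Kim2026.rankZero_padicValNat_sha_add_le_of_forall_pow_dvd_kuriharaNumber_cyclicLevel := by
  intro W _ _ p _ hp hsurj hL hfin N _ D hc hper m H
  obtain ⟨q, d, hq, hd, hval⟩ := kimShaLengthRankZeroAt_of_kimShaLengthAt W p (by omega)
    (hasIrreducibleModPGaloisRep_of_hasSurjectiveModNGaloisRep W p hsurj) hL D hper
    (hE73 W p hp hsurj hfin D hc hper)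
  -- the universal divisibility at the cyclic levels, in the currency of `KuriharaDivisibleAt`
  have hdivAt : ∀ n : ℕ, IsCyclicKolyvaginLevel W p n → KuriharaDivisibleAt W p D.f n m := by
    intro n hn k hk hkn ψ hψ
    rcases Nat.eq_zero_or_pos k with rfl | hkpos
    · haveI : Subsingleton (ZMod (p ^ 0)) := ZMod.subsingleton_iff.mpr (pow_zero p)
      exact Subsingleton.elim _ _
    · haveI : NeZero n := ⟨hkn.ne_zero⟩
      exact (Kim2026.pow_min_dvd_iff_eq_zero hk _).mp (H k hkpos n hkn (fun ℓ _ hℓ => hn.2 ℓ hℓ) ψ hψ)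
  have hm : (m : ℕ∞) ≤ kuriharaPartialInfty W p D.f := by
    show (m : ℕ∞) ≤ ⨅ i : ℕ, kuriharaPartial W p D.f i
    refine le_iInf fun i => ?_
    rw [kuriharaPartial_def]
    exact le_iInf fun n => le_iInf fun hn => le_iInf fun _ =>
      le_kuriharaDivIndex_of_divisibleAt W p D.f (hdivAt n hn)
  have hmd : m ≤ d := by exact_mod_cast hm.trans hd.le
  refine ⟨q, hq, ?_⟩
  rw [hval]
  have hcast : (m : ℤ) ≤ (d : ℤ) := Int.ofNat_le.mpr hmd
  linarith

/-- The literal-level UPPER fact A179 (harvest-2 E67, p249436) as a reading of E73, through A197.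
[cite: Kim2022StructureSelmer, Thm. 1.9 (6) (PDF p. 8), §1.5.1 (PDF p. 7)] -/
theorem kim2026_rankZero_padicValNat_sha_add_le_of_kim2026
    (hE73 : Kim2026.kuriharaPartial_vanishingOrder_eq_padicValNat_sha_add_partialInfty_of_maninConstant) :
    Kim2026.rankZero_padicValNat_sha_add_le_of_forall_pow_dvd_kuriharaNumber :=
  Kim2026.rankZero_padicValNat_sha_add_le_of_forall_pow_dvd_kuriharaNumber_of_cyclicLevel
    (kim2026_rankZero_padicValNat_sha_add_le_cyclicLevel_of_kim2026 hE73)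

end Summit.BirchSwinnertonDyer.Rank1Residual.Additive

end
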